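import Summits.QuantumFields.YangMills.Theorems.BalabanUVNodesN15CurvedGluingSmoothCutDressedGluedGauged
import Summits.QuantumFields.YangMills.Theorems.BalabanUVNodesN15TwoSpacingGluingInputLocalized
import Summits.QuantumFields.YangMills.Theorems.BalabanUVNodesN15TwoSpacingGluingCutRowsMargin
import Summits.QuantumFields.YangMills.Theorems.BalabanUVNodesN15CurvedGluingCubeSpeciesBoundary
import HarnessLib

/-!
# Route «BalabanUVNodes» (cluster K4 «SpineRates»), Track-A DAG node N15 = NE2, BACKGROUND LAYER — THE DRESSED SMOOTH-CUT CUBE ONLY SEES THE PERTURBATION CUT TO THE CUBE: the far-defect slot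
# `F_k` of the per-cube-gauge capstones (`…SmoothCutDressedGluedGauged`, `…GluedDefectGauged`) INHABITED — `M_{h}F X = 0` exactly, and `[F, M_h]X` is a FAR TAIL of the full perturbation
# (its entries from the cube's region to outside the input cut), so the local-gauge operator may be the cube's model operator with the CUT species plus an honest far defect

Cell `pub-ymgap`, seat `pub-ymgap-dag-n15-w3` (WIDTH SEAT 3∕3 on node N15, director-ym №197 ∕ HUMAN RULING D-0149; plan `W-SEAT-START-LIST.md` §n15 item 3 «LG-vector + background layers at
GENERAL small-field U» — forty-ninth piece; the producer side of the far-defect slot of this seat's g5 capstones).  `bears_on: R4∕N15 · K3⁸ SpineGivenEndpointR13SepCoPHV (stmt-QuantumFields-27366;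
K3⁷ 20544 aside — KEY MAP v2)`.  Filed `--kind proof --supports stmt-QuantumFields-27366 --as helper` — COUNT-NEUTRAL.  Theorems only; 0 `def`, 0 `sorry`.  Imports BY NAME this seat's
`…SmoothCutDressedGluedGauged` (through it file 34 `hasMaj_smoothCutDressed_loc₂` ∕ `hasMaj_fgrad∕bgrad_smoothCutDressed_loc₂` ∕ `hasMaj(_jet)_smoothCut_flat`, file 31 `smoothCut_out` ∕
`fgrad∕bgrad_smoothCut_out`, file 23 `hasMaj_dressedV_pair` ∕ `dressedV_eq_jet_comp`, B1a `bgPropV_fix`, B2 `stack` ∕ `hasMaj_stack`, dag-n15-c `commOp` ∕ `fgrad∕bgrad_comp_mulOp` ∕ `hasMaj_diag_comp`)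
and dag-n15-c FILE 57-bis `…TwoSpacingGluingInputLocalized` (`hasMaj_comp_exp_in`); nothing in the tree is modified, no landed name re-declared (file 18 `…CubeSpeciesBoundary` `stack_comp` and dag-n15-c `…CutRowsMargin` `mulOp_comp_mulOp_comm` imported BY NAME).

WHY.  In [Balaban1985BackgroundPropagators] (3.63)–(3.65) pp. 402–403 the cube propagator `G_□(U)` is built from the operator RESTRICTED to the enlarged cube `□̃`, in the cube's (3.35) gauge
`u_□`, where `U^{u_□}` is small; what `U^{u_□}` does away from `□̃` never enters.  The per-cube-gauge capstones of this seat (`hasMaj_glueInv_smoothCutDressed_localGauges` and its inverse ∕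
two-grid companions) display, per cube, the GLOBAL operator read in the cube's gauge as `M_uΔM_{uᵀ} = (Σ∇*∇ + W + N_L − V̂∘jet) + F` with the cube's perturbation `V̂` (small letter) and a
far defect `F` entering through two rows, `[F, M_h]X ≤ 1_S(y′)θ_Fe^{−ρ₃d}` and `M_hFX ≤ 1_S(y)ε_Fe^{−ρ₃d}`.  THIS FILE produces them from an exact covariance identity `M_uΔM_{uᵀ} = L − V̂_f∘jet` with
the FULL perturbation `V̂_f` (small only on the cube's region): take `V̂ := Ṽ := M_ψV̂_fC_χ` — `V̂_f` cut to the cube (output cut `ψ` = the input cut of the flat cube, pair-carrier cut `C_χ` by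
the sharp cut-off `χ`) — and `F := −(V̂_f − Ṽ)∘jet`.  Then (§1, generic pair algebra): the dressed pair `X̂ = (1 − ŜV̂)⁻¹Ŝ` is `C`-localized whenever `Ŝ` is (★ `jetCut_comp_dressedV`); hence
★ `mulOp_comp_farDefect_comp_dressed`: `M_h∘F∘X = 0` for `M_hM_ψ = M_h` — the far defect is INVISIBLE behind the partition function, `ε_F = 0`; ★ `localOp_eq_cut_add_farDefect` is the `hcov`
shape; ★★ `commOp_farDefect_comp_dressed_eq`: `[F, M_h]∘X = −((1 − M_ψ)V̂_fC_χ)∘(jet∘M_h∘X)` when the jet of `M_h`-cut fields is `C_χ`-localized.  §2 (the smooth-cut cube of this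
lineage): ★ `jetCut_comp_jet_mulOp_comp` — `C_χ∘jet∘M_g∘T = jet∘M_g∘T` for every `T` when `g`, its unit shifts and `∇^±g` live in `{χ = 1}` (file 31's insertions; at `g = χ̃` this is
`C_χ∘Ŝ = Ŝ` from file 44's own hypotheses `hχ, hs′, hsb′, hdd′, hddb′`); ★ `hasMaj_jet_mulOp_comp_loc₂` — the two-sided row of `jet∘M_h∘X` from file 34's rows of `X`, `∇^±X` and the
partition's letters (`B̄′(1 + c₁)`); ★ `hasMaj_mulOp_farDefect_smoothCutDressed` — the `hFX` row with `ε_F = 0`; ★★ `hasMaj_commOp_farDefect_smoothCutDressed` — the `hFK` row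
`[F, M_h]X ≤ 1_S(y′)·(θ_FB̄′(1 + c₁)c_r)·e^{−ρ₃d}` from ONE displayed far letter `(1 − M_ψ)V̂_fC_χ ≤ θ_Fe^{−ρ_Fd}` (`ρ₃ + σ ≤ ρ_F`): the entries of the full perturbation from the `χ`-region to
OUTSIDE `ψ` — zero for the range-one species part once the margin exceeds one, a far tail of the nonlocal part otherwise.  PLUG-IN: in `hasMaj_glueInv_smoothCutDressed_localGauges` ∕
`glueInv_smoothCutDressed_localGauges_inverse` take per cube `V k := M_{ψ_k}V̂_{f,k}C_{χ_k}`, `F k := −(V̂_{f,k} − V k)∘jet`, `hcov k := localOp_eq_cut_add_farDefect ▸` (exact covariance),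
`hFX k :=` ★ (with `ε_F = 0`), `hFK k :=` ★★ (with `θ_F ↦ θ_FB̄′(1 + c₁)c_r`).

HONEST FRAMING ∕ LIMITS.  Finite-dimensional operator algebra + block-majorant bookkeeping over DISPLAYED rows (file 34's cut rows, the partition's letters and support insertions, the far
letter of the full perturbation); the (3.35) gauges, the species of `U^{u_□}`, its letter on the cube's region and its far letter are NOT produced here (located: dag-n15-w2 g5's axial-gauge ∕
curved-species files; the far letter of the LOCAL species is `0` by range, of Bałaban's nonlocal `P₁(A)` a tail of (3.49)∕(3.68)∕(3.77) — lane-held); nothing of [B5]∕[B6]∕[B9] asserted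
((2.93) p. 239, (2.133)–(2.135) p. 247, (3.34)–(3.35) p. 396, (3.63)–(3.65) pp. 402–403 = SHAPES ∕ MECHANISM).  NE2⁺ NOT PRINTED, NOT proved; N15 NOT discharged; K3⁸ OPEN, skeleton v6
untouched; counts of record UNMOVED (typed 28∕28 · discharged 5∕27); one finite 𝕋⁴ at fixed ε — NOT infinite volume, NOT OS on ℝ⁴, NOT a mass gap, NOT Clay; R4 closes the conditional finite-𝕋⁴
rung `BalabanLadder.UV` only.  Restate-immune (no Theses import).
-/

set_option autoImplicit false

noncomputable section
open scoped BigOperators Matrix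
open Finset

namespace Summit.QuantumFields.YangMills.BalabanUVNodes.N15.CurvedSpecies

open Literature.MathematicalPhysics.QuantumFieldTheory.Balaban1983to89
open Literature.MathematicalPhysics.QuantumFieldTheory.Balaban1983to89.B11SectG (BlockNorm HasMaj RowSum hasMaj_comp hasMaj_zero)
open Literature.MathematicalPhysics.QuantumFieldTheory.Balaban1983to89.B6RandomWalk (Triangle254)
open Literature.MathematicalPhysics.QuantumFieldTheory.Balaban1983to89.B6Prop26Gluing (mulOp mulOp_apply ind ind_nonneg ind_le_one)
open Literature.MathematicalPhysics.QuantumFieldTheory.Balaban1983to89.T4EtaRateCoeffDefect (diagK diagK_nonneg hasMaj_mulOp)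
open Summit.QuantumFields.YangMills.BalabanUVNodes.N15.MatrixSpecies (mmulOp liftBlk liftEquiv liftEquiv_apply liftEquiv_symm_apply)
open Summit.QuantumFields.YangMills.BalabanUVNodes.N15.BackgroundLayer (fgrad bgrad fgradAdj stack projO blkPair bgPropV bgPropV_fix stack_apply_none stack_apply_some hasMaj_stack)
open Summit.QuantumFields.YangMills.BalabanUVNodes.N15.Gluing (commOp lapOp parametrix remainder glueInv hasMaj_diag_comp hasMaj_comp_diag hasMaj_comp_exp_in fgrad_comp_mulOp
  bgrad_comp_mulOp mulOp_comp_mulOp_comm)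

/-! ## §1 Algebra on the pair carrier: site cut-offs, the dressed pair only sees the perturbation cut to the cube, the far defect -/

section Algebra

variable {Y K E : Type} [AddCommGroup E] [Module ℝ E]

/-- A site cut-off on the pair∕jet carrier acts componentwise on a stack: `C_a ∘ stack G D = stack (M_aG) (M_aD_j)`, `C_a = M_{a∘pr₁}`. [folklore] -/
theorem mulOp_pair_comp_stack (a : Y → ℝ) (G : E →ₗ[ℝ] (Y → ℝ)) (D : K → E →ₗ[ℝ] (Y → ℝ)) :
    mulOp (fun q : Y × Option K => a q.1) ∘ₗ stack G D = stack (mulOp a ∘ₗ G) (fun j => mulOp a ∘ₗ D j) := by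
  refine LinearMap.ext fun v => funext fun q => ?_
  rcases q with ⟨y, _ | j⟩
  · simp only [LinearMap.comp_apply, mulOp_apply, stack_apply_none]
  · simp only [LinearMap.comp_apply, mulOp_apply, stack_apply_some]

variable [Fintype Y] [Fintype K] [DecidableEq Y] [DecidableEq K] {G₀ : (Y → ℝ) →ₗ[ℝ] (Y → ℝ)} {D Dq : K → (Y → ℝ) →ₗ[ℝ] (Y → ℝ)}
  {V : (Y × Option K → ℝ) →ₗ[ℝ] (Y → ℝ)} {c : Y × Option K → ℝ}

/-- ★ **THE DRESSED PAIR IS LOCALIZED WHERE THE FLAT PAIR IS**: `C∘Ŝ = Ŝ` ⟹ `C∘X̂ = X̂` for `X̂ = (1 − ŜV̂)⁻¹Ŝ` and any cut-off `C` of the pair carrier (B1a `bgPropV_fix`: `X̂ = Ŝ + ŜV̂X̂`).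
[cite: Balaban1985BackgroundPropagators, (3.63)–(3.65) pp.402–403 (the cube propagator lives on the cube: shape)] -/
theorem jetCut_comp_dressedV (hC : mulOp c ∘ₗ stack G₀ D = stack G₀ D) (hunit : IsUnit (1 - LinearMap.toMatrix' (stack G₀ D ∘ₗ V))) :
    mulOp c ∘ₗ bgPropV (stack G₀ D) V = bgPropV (stack G₀ D) V := by
  have e := bgPropV_fix hunit
  conv_lhs => rw [e]
  rw [LinearMap.comp_add, show mulOp c ∘ₗ ((stack G₀ D ∘ₗ V) ∘ₗ bgPropV (stack G₀ D) V) = ((mulOp c ∘ₗ stack G₀ D) ∘ₗ V) ∘ₗ bgPropV (stack G₀ D) V by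
    simp only [LinearMap.comp_assoc], hC]
  exact e.symm

/-- ★ **THE CUBE's `hloc` ONLY SEES THE CUT PERTURBATION — the far defect is invisible behind the partition function**: with `Ṽ := M_ψ∘V̂_f∘C` (the full perturbation `V̂_f` cut to the cube:
output cut `ψ`, pair-carrier input cut `C` with `C∘Ŝ = Ŝ`) and the FAR DEFECT `F := −(V̂_f − Ṽ)∘jet`, for the dressed cube `X = pr₀X̂` built from ANY perturbation and `M_hM_ψ = M_h`:
`M_h∘F∘X = 0`. [cite: Balaban1985BackgroundPropagators, (3.63)–(3.65) pp.402–403 (the cube propagator is computed from the operator restricted to the cube: mechanism)] -/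
theorem mulOp_comp_farDefect_comp_dressed (hD : ∀ j, D j = Dq j ∘ₗ G₀) (hunit : IsUnit (1 - LinearMap.toMatrix' (stack G₀ D ∘ₗ V))) (hC : mulOp c ∘ₗ stack G₀ D = stack G₀ D)
    {h ψ : Y → ℝ} (hhψ : mulOp h ∘ₗ mulOp ψ = mulOp h) (Vf : (Y × Option K → ℝ) →ₗ[ℝ] (Y → ℝ)) :
    mulOp h ∘ₗ (-((Vf - mulOp ψ ∘ₗ Vf ∘ₗ mulOp c) ∘ₗ stack LinearMap.id Dq)) ∘ₗ (projO none ∘ₗ bgPropV (stack G₀ D) V) = 0 := by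
  have hJ : stack LinearMap.id Dq ∘ₗ (projO none ∘ₗ bgPropV (stack G₀ D) V) = bgPropV (stack G₀ D) V := (dressedV_eq_jet_comp hD hunit).symm
  have hX := jetCut_comp_dressedV hC hunit
  have h1 : (-((Vf - mulOp ψ ∘ₗ Vf ∘ₗ mulOp c) ∘ₗ stack LinearMap.id Dq)) ∘ₗ (projO none ∘ₗ bgPropV (stack G₀ D) V) = -(Vf ∘ₗ bgPropV (stack G₀ D) V - mulOp ψ ∘ₗ Vf ∘ₗ bgPropV (stack G₀ D) V) := by
    rw [LinearMap.neg_comp, LinearMap.comp_assoc, hJ, LinearMap.sub_comp]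
    simp only [LinearMap.comp_assoc, hX]
  rw [h1, LinearMap.comp_neg, LinearMap.comp_sub, ← LinearMap.comp_assoc (Vf ∘ₗ bgPropV (stack G₀ D) V) (mulOp ψ) (mulOp h), hhψ, sub_self, neg_zero]

omit [Fintype Y] [Fintype K] [DecidableEq Y] [DecidableEq K] in
/-- ★ **THE LOCAL-GAUGE OPERATOR = THE CUBE's MODEL OPERATOR + THE FAR DEFECT** (file 47's `hcov` shape from an exact covariance identity): `L − V̂_f∘jet = (L − Ṽ∘jet) + F` with `Ṽ = M_ψV̂_fC`,
`F = −(V̂_f − Ṽ)∘jet`. [cite: Balaban1985BackgroundPropagators, (3.34)–(3.35) p.396, (3.50)–(3.53) p.400 (shapes)] -/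
theorem localOp_eq_cut_add_farDefect (L : (Y → ℝ) →ₗ[ℝ] (Y → ℝ)) (Vf : (Y × Option K → ℝ) →ₗ[ℝ] (Y → ℝ)) (ψ : Y → ℝ) :
    L - Vf ∘ₗ stack LinearMap.id Dq = (L - (mulOp ψ ∘ₗ Vf ∘ₗ mulOp c) ∘ₗ stack LinearMap.id Dq) + -((Vf - mulOp ψ ∘ₗ Vf ∘ₗ mulOp c) ∘ₗ stack LinearMap.id Dq) := by
  rw [LinearMap.sub_comp]
  abel

/-- ★★ **THE REMAINDER ROW OF THE FAR DEFECT IS A FAR TAIL**: if moreover the jet of `M_h`-cut fields is `C`-localized (`C∘jet∘M_h∘X = jet∘M_h∘X`), then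
`[F, M_h]∘X = −((1 − M_ψ)∘V̂_f∘C)∘(jet∘M_h∘X)` — the far defect acts on the cube only through the entries of the full perturbation from the `C`-region to OUTSIDE `ψ`.
[cite: Balaban1985BackgroundPropagators, (3.34)–(3.35) p.396, (3.63)–(3.65) pp.402–403 (mechanism); Balaban1984PropagatorsII, (2.93) p.239 (shape)] -/
theorem commOp_farDefect_comp_dressed_eq (hD : ∀ j, D j = Dq j ∘ₗ G₀) (hunit : IsUnit (1 - LinearMap.toMatrix' (stack G₀ D ∘ₗ V))) (hC : mulOp c ∘ₗ stack G₀ D = stack G₀ D)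
    {h ψ : Y → ℝ} (hhψ : mulOp h ∘ₗ mulOp ψ = mulOp h) (Vf : (Y × Option K → ℝ) →ₗ[ℝ] (Y → ℝ))
    (hY : mulOp c ∘ₗ (stack LinearMap.id Dq ∘ₗ mulOp h ∘ₗ (projO none ∘ₗ bgPropV (stack G₀ D) V)) = stack LinearMap.id Dq ∘ₗ mulOp h ∘ₗ (projO none ∘ₗ bgPropV (stack G₀ D) V)) :
    commOp (-((Vf - mulOp ψ ∘ₗ Vf ∘ₗ mulOp c) ∘ₗ stack LinearMap.id Dq)) h ∘ₗ (projO none ∘ₗ bgPropV (stack G₀ D) V) =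
      -(((LinearMap.id - mulOp ψ) ∘ₗ Vf ∘ₗ mulOp c) ∘ₗ (stack LinearMap.id Dq ∘ₗ mulOp h ∘ₗ (projO none ∘ₗ bgPropV (stack G₀ D) V))) := by
  have h0 := mulOp_comp_farDefect_comp_dressed hD hunit hC hhψ Vf
  have h1 : commOp (-((Vf - mulOp ψ ∘ₗ Vf ∘ₗ mulOp c) ∘ₗ stack LinearMap.id Dq)) h ∘ₗ (projO none ∘ₗ bgPropV (stack G₀ D) V) =
      (-((Vf - mulOp ψ ∘ₗ Vf ∘ₗ mulOp c) ∘ₗ stack LinearMap.id Dq)) ∘ₗ mulOp h ∘ₗ (projO none ∘ₗ bgPropV (stack G₀ D) V) -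
        mulOp h ∘ₗ (-((Vf - mulOp ψ ∘ₗ Vf ∘ₗ mulOp c) ∘ₗ stack LinearMap.id Dq)) ∘ₗ (projO none ∘ₗ bgPropV (stack G₀ D) V) := by
    simp only [commOp, LinearMap.sub_comp, LinearMap.comp_assoc]
  rw [h1, h0, sub_zero]
  have h2 : (-((Vf - mulOp ψ ∘ₗ Vf ∘ₗ mulOp c) ∘ₗ stack LinearMap.id Dq)) ∘ₗ mulOp h ∘ₗ (projO none ∘ₗ bgPropV (stack G₀ D) V) =
      -((Vf - mulOp ψ ∘ₗ Vf ∘ₗ mulOp c) ∘ₗ (stack LinearMap.id Dq ∘ₗ mulOp h ∘ₗ (projO none ∘ₗ bgPropV (stack G₀ D) V))) := by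
    simp only [LinearMap.neg_comp, LinearMap.comp_assoc]
  rw [h2]
  congr 1
  refine LinearMap.ext fun v => ?_
  have hv := LinearMap.congr_fun hY v
  simp only [LinearMap.comp_apply, LinearMap.sub_apply, LinearMap.id_apply] at hv ⊢
  rw [hv]

end Algebra

/-! ## §2 The smooth-cut cube: its stack and the jets of partition-cut fields are cut-localized; rows of the far defect against the dressed cube -/

section SmoothCut

variable {X ι J : Type} [Fintype X] [DecidableEq X] [Fintype ι] [DecidableEq ι] [Fintype J] [DecidableEq J] {g : B6.Geometry} (blk : X → g.Site) (τ : J → X ≃ X) (n : ℝ)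
  {σ cr : ℝ} {N : (X × ι → ℝ) →ₗ[ℝ] (X × ι → ℝ)} {V Vf : ((X × ι) × Option (J ⊕ J) → ℝ) →ₗ[ℝ] (X × ι → ℝ)} {χX χtX ψX gX hX : X → ℝ} {S : Set g.Site} {β β₁ ct δ : ℝ}

omit [Fintype X] [DecidableEq X] [Fintype ι] [DecidableEq ι] [Fintype J] [DecidableEq J] in
/-- ★ **THE JET OF A CUT FIELD IS CUT-LOCALIZED**: for site functions `g`, `χ` with `χg = g`, `χ(g∘e_μ^{±1}) = g∘e_μ^{±1}`, `χ∇^±_μg = ∇^±_μg` (the support of `g` and of its shifts inside `{χ = 1}`):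
`C_χ∘jet∘M_g∘T = jet∘M_g∘T` for EVERY `T` (file 31 `smoothCut_out` ∕ `fgrad∕bgrad_smoothCut_out` per component). [cite: Balaban1984PropagatorsII, (2.133) p.247 (shape)] -/
theorem jetCut_comp_jet_mulOp_comp (hχg : mulOp (fun p : X × ι => χX p.1) ∘ₗ mulOp (fun p : X × ι => gX p.1) = mulOp (fun p : X × ι => gX p.1))
    (hs' : ∀ μ, mulOp (fun p : X × ι => χX p.1) ∘ₗ mulOp ((fun p : X × ι => gX p.1) ∘ (liftEquiv (τ μ) ι)) = mulOp ((fun p : X × ι => gX p.1) ∘ (liftEquiv (τ μ) ι)))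
    (hsb' : ∀ μ, mulOp (fun p : X × ι => χX p.1) ∘ₗ mulOp ((fun p : X × ι => gX p.1) ∘ (liftEquiv (τ μ) ι).symm) = mulOp ((fun p : X × ι => gX p.1) ∘ (liftEquiv (τ μ) ι).symm))
    (hdd' : ∀ μ, mulOp (fun p : X × ι => χX p.1) ∘ₗ mulOp (fgrad n (liftEquiv (τ μ) ι) (fun p : X × ι => gX p.1)) = mulOp (fgrad n (liftEquiv (τ μ) ι) (fun p : X × ι => gX p.1)))
    (hddb' : ∀ μ, mulOp (fun p : X × ι => χX p.1) ∘ₗ mulOp (bgrad n (liftEquiv (τ μ) ι) (fun p : X × ι => gX p.1)) = mulOp (bgrad n (liftEquiv (τ μ) ι) (fun p : X × ι => gX p.1)))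
    (T : (X × ι → ℝ) →ₗ[ℝ] (X × ι → ℝ)) :
    mulOp (fun q : (X × ι) × Option (J ⊕ J) => χX q.1.1) ∘ₗ (stack LinearMap.id (fun j => Sum.elim (fun μ => fgrad n (liftEquiv (τ μ) ι)) (fun μ => bgrad n (liftEquiv (τ μ) ι)) j) ∘ₗ
        mulOp (fun p : X × ι => gX p.1) ∘ₗ T) =
      stack LinearMap.id (fun j => Sum.elim (fun μ => fgrad n (liftEquiv (τ μ) ι)) (fun μ => bgrad n (liftEquiv (τ μ) ι)) j) ∘ₗ mulOp (fun p : X × ι => gX p.1) ∘ₗ T := by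
  have hs : ∀ μ, mulOp ((fun p : X × ι => gX p.1) ∘ (liftEquiv (τ μ) ι)) ∘ₗ mulOp (fun p : X × ι => χX p.1) = mulOp ((fun p : X × ι => gX p.1) ∘ (liftEquiv (τ μ) ι)) :=
    fun μ => by rw [mulOp_comp_mulOp_comm]; exact hs' μ
  have hsb : ∀ μ, mulOp ((fun p : X × ι => gX p.1) ∘ (liftEquiv (τ μ) ι).symm) ∘ₗ mulOp (fun p : X × ι => χX p.1) = mulOp ((fun p : X × ι => gX p.1) ∘ (liftEquiv (τ μ) ι).symm) :=
    fun μ => by rw [mulOp_comp_mulOp_comm]; exact hsb' μ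
  have hdd : ∀ μ, mulOp (fgrad n (liftEquiv (τ μ) ι) (fun p : X × ι => gX p.1)) ∘ₗ mulOp (fun p : X × ι => χX p.1) = mulOp (fgrad n (liftEquiv (τ μ) ι) (fun p : X × ι => gX p.1)) :=
    fun μ => by rw [mulOp_comp_mulOp_comm]; exact hdd' μ
  have hddb : ∀ μ, mulOp (bgrad n (liftEquiv (τ μ) ι) (fun p : X × ι => gX p.1)) ∘ₗ mulOp (fun p : X × ι => χX p.1) = mulOp (bgrad n (liftEquiv (τ μ) ι) (fun p : X × ι => gX p.1)) :=
    fun μ => by rw [mulOp_comp_mulOp_comm]; exact hddb' μ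
  rw [stack_comp, LinearMap.id_comp, mulOp_pair_comp_stack (fun p : X × ι => χX p.1), smoothCut_out hχg]
  congr 1
  funext j
  rcases j with μ | μ
  · simp only [Sum.elim_inl]
    exact fgrad_smoothCut_out n (liftEquiv (τ μ) ι) (hs μ) (hdd μ) (hs' μ) (hdd' μ)
  · simp only [Sum.elim_inr]
    exact bgrad_smoothCut_out n (liftEquiv (τ μ) ι) (hsb μ) (hddb μ) (hsb' μ) (hddb' μ)

omit [DecidableEq X] [DecidableEq ι] [DecidableEq J] in
/-- ★ **TWO-SIDED ROW OF THE JET OF A PARTITION-CUT OPERATOR**: `T ≤ 1_S1_S·Be^{−ρd}`, `∇^±_μT ≤ 1_S1_S·Be^{−ρd}`, `|g| ≤ 1`, `|∇^±g| ≤ c₁` ⟹ `jet∘M_g∘T ≤ 1_S1_S·(B + c₁B)e^{−ρd}` (lattice Leibniz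
`∇(gT) = (g∘e)∇T + (∇g)T`, n15-c `fgrad∕bgrad_comp_mulOp`; `hasMaj_stack`). [cite: Balaban1984PropagatorsI, (1.126)–(1.128) p.38 (Leibniz shape); Balaban1984PropagatorsII, (2.133) p.247] -/
theorem hasMaj_jet_mulOp_comp_loc₂ {T : (X × ι → ℝ) →ₗ[ℝ] (X × ι → ℝ)} {B c₁ ρ : ℝ} (hB : 0 ≤ B) (hc₁ : 0 ≤ c₁) (hg : ∀ x, |gX x| ≤ 1)
    (hg1 : ∀ μ p, |fgrad n (liftEquiv (τ μ) ι) (fun p : X × ι => gX p.1) p| ≤ c₁) (hg1b : ∀ μ p, |bgrad n (liftEquiv (τ μ) ι) (fun p : X × ι => gX p.1) p| ≤ c₁)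
    (hT : HasMaj (BlockNorm.ofBlocks g (liftBlk blk ι)) (BlockNorm.ofBlocks g (liftBlk blk ι)) T (fun y y' => ind S y * ind S y' * (B * Real.exp (-(ρ * g.dist y y')))))
    (hTF : ∀ μ, HasMaj (BlockNorm.ofBlocks g (liftBlk blk ι)) (BlockNorm.ofBlocks g (liftBlk blk ι)) (fgrad n (liftEquiv (τ μ) ι) ∘ₗ T) (fun y y' => ind S y * ind S y' * (B * Real.exp (-(ρ * g.dist y y')))))
    (hTB : ∀ μ, HasMaj (BlockNorm.ofBlocks g (liftBlk blk ι)) (BlockNorm.ofBlocks g (liftBlk blk ι)) (bgrad n (liftEquiv (τ μ) ι) ∘ₗ T) (fun y y' => ind S y * ind S y' * (B * Real.exp (-(ρ * g.dist y y'))))) :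
    HasMaj (BlockNorm.ofBlocks g (liftBlk blk ι)) (BlockNorm.ofBlocks g (blkPair (liftBlk blk ι))) (stack LinearMap.id (fun j => Sum.elim (fun μ => fgrad n (liftEquiv (τ μ) ι)) (fun μ => bgrad n (liftEquiv (τ μ) ι)) j) ∘ₗ mulOp (fun p : X × ι => gX p.1) ∘ₗ T)
      (fun y y' => ind S y * ind S y' * ((B + c₁ * B) * Real.exp (-(ρ * g.dist y y')))) := by
  have hMg : HasMaj (BlockNorm.ofBlocks g (liftBlk blk ι)) (BlockNorm.ofBlocks g (liftBlk blk ι)) (mulOp (fun p : X × ι => gX p.1)) (diagK fun _ => (1 : ℝ)) := hasMaj_mulOp (liftBlk blk ι) (fun _ => zero_le_one) fun p => hg p.1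
  have hMs : ∀ μ, HasMaj (BlockNorm.ofBlocks g (liftBlk blk ι)) (BlockNorm.ofBlocks g (liftBlk blk ι)) (mulOp ((fun p : X × ι => gX p.1) ∘ (liftEquiv (τ μ) ι))) (diagK fun _ => (1 : ℝ)) :=
    fun μ => hasMaj_mulOp (liftBlk blk ι) (fun _ => zero_le_one) fun p => hg _
  have hMsb : ∀ μ, HasMaj (BlockNorm.ofBlocks g (liftBlk blk ι)) (BlockNorm.ofBlocks g (liftBlk blk ι)) (mulOp ((fun p : X × ι => gX p.1) ∘ (liftEquiv (τ μ) ι).symm)) (diagK fun _ => (1 : ℝ)) :=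
    fun μ => hasMaj_mulOp (liftBlk blk ι) (fun _ => zero_le_one) fun p => hg _
  have hMd : ∀ μ, HasMaj (BlockNorm.ofBlocks g (liftBlk blk ι)) (BlockNorm.ofBlocks g (liftBlk blk ι)) (mulOp (fgrad n (liftEquiv (τ μ) ι) (fun p : X × ι => gX p.1))) (diagK fun _ => c₁) := fun μ => hasMaj_mulOp (liftBlk blk ι) (fun _ => hc₁) (hg1 μ)
  have hMdb : ∀ μ, HasMaj (BlockNorm.ofBlocks g (liftBlk blk ι)) (BlockNorm.ofBlocks g (liftBlk blk ι)) (mulOp (bgrad n (liftEquiv (τ μ) ι) (fun p : X × ι => gX p.1))) (diagK fun _ => c₁) := fun μ => hasMaj_mulOp (liftBlk blk ι) (fun _ => hc₁) (hg1b μ)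
  have hle : ∀ y y' : g.Site, (1 : ℝ) * (ind S y * ind S y' * (B * Real.exp (-(ρ * g.dist y y')))) ≤ ind S y * ind S y' * ((B + c₁ * B) * Real.exp (-(ρ * g.dist y y'))) := fun y y' => by
    rw [one_mul]
    exact mul_le_mul_of_nonneg_left (mul_le_mul_of_nonneg_right (by nlinarith [mul_nonneg hc₁ hB]) (Real.exp_nonneg _)) (mul_nonneg (ind_nonneg _ _) (ind_nonneg _ _))
  rw [stack_comp, LinearMap.id_comp]
  refine hasMaj_stack (liftBlk blk ι) (fun y y' => mul_nonneg (mul_nonneg (ind_nonneg _ _) (ind_nonneg _ _)) (mul_nonneg (by positivity) (Real.exp_nonneg _))) ((hasMaj_diag_comp (liftBlk blk ι) (fun _ => zero_le_one) hMg hT).mono hle) ?_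
  intro j
  rcases j with μ | μ
  · simp only [Sum.elim_inl]
    rw [← LinearMap.comp_assoc, fgrad_comp_mulOp, LinearMap.add_comp, LinearMap.comp_assoc]
    exact ((hasMaj_diag_comp (liftBlk blk ι) (fun _ => zero_le_one) (hMs μ) (hTF μ)).add (hasMaj_diag_comp (liftBlk blk ι) (fun _ => hc₁) (hMd μ) hT)).mono fun y y' => le_of_eq (by ring)
  · simp only [Sum.elim_inr]
    rw [← LinearMap.comp_assoc, bgrad_comp_mulOp, LinearMap.add_comp, LinearMap.comp_assoc]
    exact ((hasMaj_diag_comp (liftBlk blk ι) (fun _ => zero_le_one) (hMsb μ) (hTB μ)).add (hasMaj_diag_comp (liftBlk blk ι) (fun _ => hc₁) (hMdb μ) hT)).mono fun y y' => le_of_eq (by ring)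

omit [Fintype X] [DecidableEq X] [Fintype ι] [DecidableEq ι] [Fintype J] [DecidableEq J] in
/-- The jet of a composed operator is the stack of the piece and its derived pieces: `jet∘G = stack G (∇_jG)`. [folklore] -/
theorem jet_comp_eq_stack (G : (X × ι → ℝ) →ₗ[ℝ] (X × ι → ℝ)) :
    stack LinearMap.id (fun j => Sum.elim (fun μ => fgrad n (liftEquiv (τ μ) ι)) (fun μ => bgrad n (liftEquiv (τ μ) ι)) j) ∘ₗ G = stack G (fun j => Sum.elim (fun μ => fgrad n (liftEquiv (τ μ) ι)) (fun μ => bgrad n (liftEquiv (τ μ) ι)) j ∘ₗ G) := by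
  rw [stack_comp, LinearMap.id_comp]

/-- ★ **THE PARTITION-CUT FAR DEFECT VANISHES ON THE DRESSED SMOOTH-CUT CUBE** (file 47∕48's `hFX` row with `ε_F = 0`): for the dressed smooth-cut cube `X` of this lineage (any perturbation `V̂`
behind it), the full perturbation `V̂_f`, its cut `Ṽ = M_ψV̂_fC_χ` and `F = −(V̂_f − Ṽ)∘jet`: `M_hFX ≤ 1_S(y)·0`. [cite: Balaban1985BackgroundPropagators, (3.63)–(3.65) pp.402–403 (mechanism)] -/
theorem hasMaj_mulOp_farDefect_smoothCutDressed
    (htri : Triangle254 g) (hd : ∀ a b : g.Site, 0 ≤ g.dist a b) (hrow : RowSum g σ cr) (hσ : 0 ≤ σ) {ρ₁ ρ₂ δV R : ℝ} (hβ : 0 ≤ β) (hβ₁ : 0 ≤ β₁)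
    (hct : 0 ≤ ct) (hR : 0 ≤ R) (hcr : 0 ≤ cr) (hσρ : σ ≤ ρ₁) (hρ₁V : ρ₁ ≤ δV) (hρ₁G : ρ₁ + σ ≤ δ) (hρ₂ : 0 ≤ ρ₂) (hρ₂₁ : ρ₂ + σ ≤ ρ₁)
    (hχt : ∀ x, |χtX x| ≤ 1)
    (hdχt : ∀ μ p, |fgrad n (liftEquiv (τ μ) ι) (fun p : X × ι => χtX p.1) p| ≤ ct) (hdχtb : ∀ μ p, |bgrad n (liftEquiv (τ μ) ι) (fun p : X × ι => χtX p.1) p| ≤ ct)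
    (hsub : mulOp (fun p : X × ι => χtX p.1) ∘ₗ mulOp (fun p : X × ι => χX p.1) = mulOp (fun p : X × ι => χtX p.1))
    (hχ : mulOp (fun p : X × ι => χX p.1) ∘ₗ mulOp (fun p : X × ι => χtX p.1) = mulOp (fun p : X × ι => χtX p.1))
    (hs : ∀ μ, mulOp ((fun p : X × ι => χtX p.1) ∘ (liftEquiv (τ μ) ι)) ∘ₗ mulOp (fun p : X × ι => χX p.1) = mulOp ((fun p : X × ι => χtX p.1) ∘ (liftEquiv (τ μ) ι)))
    (hsb : ∀ μ, mulOp ((fun p : X × ι => χtX p.1) ∘ (liftEquiv (τ μ) ι).symm) ∘ₗ mulOp (fun p : X × ι => χX p.1) = mulOp ((fun p : X × ι => χtX p.1) ∘ (liftEquiv (τ μ) ι).symm))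
    (hdd : ∀ μ, mulOp (fgrad n (liftEquiv (τ μ) ι) (fun p : X × ι => χtX p.1)) ∘ₗ mulOp (fun p : X × ι => χX p.1) = mulOp (fgrad n (liftEquiv (τ μ) ι) (fun p : X × ι => χtX p.1)))
    (hddb : ∀ μ, mulOp (bgrad n (liftEquiv (τ μ) ι) (fun p : X × ι => χtX p.1)) ∘ₗ mulOp (fun p : X × ι => χX p.1) = mulOp (bgrad n (liftEquiv (τ μ) ι) (fun p : X × ι => χtX p.1)))
    (hs' : ∀ μ, mulOp (fun p : X × ι => χX p.1) ∘ₗ mulOp ((fun p : X × ι => χtX p.1) ∘ (liftEquiv (τ μ) ι)) = mulOp ((fun p : X × ι => χtX p.1) ∘ (liftEquiv (τ μ) ι)))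
    (hsb' : ∀ μ, mulOp (fun p : X × ι => χX p.1) ∘ₗ mulOp ((fun p : X × ι => χtX p.1) ∘ (liftEquiv (τ μ) ι).symm) = mulOp ((fun p : X × ι => χtX p.1) ∘ (liftEquiv (τ μ) ι).symm))
    (hdd' : ∀ μ, mulOp (fun p : X × ι => χX p.1) ∘ₗ mulOp (fgrad n (liftEquiv (τ μ) ι) (fun p : X × ι => χtX p.1)) = mulOp (fgrad n (liftEquiv (τ μ) ι) (fun p : X × ι => χtX p.1)))
    (hddb' : ∀ μ, mulOp (fun p : X × ι => χX p.1) ∘ₗ mulOp (bgrad n (liftEquiv (τ μ) ι) (fun p : X × ι => χtX p.1)) = mulOp (bgrad n (liftEquiv (τ μ) ι) (fun p : X × ι => χtX p.1)))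
    (hcut : HasMaj (BlockNorm.ofBlocks g (liftBlk blk ι)) (BlockNorm.ofBlocks g (liftBlk blk ι)) (mulOp (fun p : X × ι => χX p.1) ∘ₗ N) (fun y y' => ind S y * ind S y' * (β * Real.exp (-(δ * g.dist y y')))))
    (hcutF : ∀ μ, HasMaj (BlockNorm.ofBlocks g (liftBlk blk ι)) (BlockNorm.ofBlocks g (liftBlk blk ι)) (mulOp (fun p : X × ι => χX p.1) ∘ₗ (fgrad n (liftEquiv (τ μ) ι) ∘ₗ N)) (fun y y' => ind S y * ind S y' * (β₁ * Real.exp (-(δ * g.dist y y')))))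
    (hcutB : ∀ μ, HasMaj (BlockNorm.ofBlocks g (liftBlk blk ι)) (BlockNorm.ofBlocks g (liftBlk blk ι)) (mulOp (fun p : X × ι => χX p.1) ∘ₗ (bgrad n (liftEquiv (τ μ) ι) ∘ₗ N)) (fun y y' => ind S y * ind S y' * (β₁ * Real.exp (-(δ * g.dist y y')))))
    (hV : HasMaj (BlockNorm.ofBlocks g (blkPair (liftBlk blk ι))) (BlockNorm.ofBlocks g (liftBlk blk ι)) V (fun y y' => R * Real.exp (-(δV * g.dist y y'))))
    (hq : (β + (β₁ + ct * β)) * (R * cr) * cr < 1)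
    (hhψ : mulOp (fun p : X × ι => hX p.1) ∘ₗ mulOp (fun p : X × ι => ψX p.1) = mulOp (fun p : X × ι => hX p.1)) (ρ₃ : ℝ) :
    HasMaj (BlockNorm.ofBlocks g (liftBlk blk ι)) (BlockNorm.ofBlocks g (liftBlk blk ι)) (mulOp (fun p : X × ι => hX p.1) ∘ₗ (-((Vf - mulOp (fun p : X × ι => ψX p.1) ∘ₗ Vf ∘ₗ mulOp (fun q : (X × ι) × Option (J ⊕ J) => χX q.1.1)) ∘ₗ stack LinearMap.id (fun j => Sum.elim (fun μ => fgrad n (liftEquiv (τ μ) ι)) (fun μ => bgrad n (liftEquiv (τ μ) ι)) j))) ∘ₗ (projO none ∘ₗ bgPropV (stack (mulOp (fun p : X × ι => χtX p.1) ∘ₗ N) (fun j => Sum.elim (fun μ => fgrad n (liftEquiv (τ μ) ι)) (fun μ => bgrad n (liftEquiv (τ μ) ι)) j ∘ₗ (mulOp (fun p : X × ι => χtX p.1) ∘ₗ N))) V))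
      (fun y y' => ind S y * (0 * Real.exp (-(ρ₃ * g.dist y y')))) := by
  have hβb : 0 ≤ β + (β₁ + ct * β) := by positivity
  have hG := hasMaj_smoothCut_flat blk (S := S) hβ hβ₁ hct hχt hsub hcut
  have hD := hasMaj_jet_smoothCut_flat blk τ n (S := S) hβ hβ₁ hct hχt hdχt hdχtb hs hsb hdd hddb hcut hcutF hcutB
  have hunit := (hasMaj_dressedV_pair blk htri hd hrow hσ hβb hR hcr hσρ hρ₁V hρ₁G hρ₂ hρ₂₁ hG hD hV hq).1
  have hS := jetCut_comp_jet_mulOp_comp τ n hχ hs' hsb' hdd' hddb' N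
  rw [jet_comp_eq_stack] at hS
  rw [mulOp_comp_farDefect_comp_dressed (fun _ => rfl) hunit hS hhψ Vf]
  exact (hasMaj_zero _ _).mono fun y y' => le_of_eq (by ring)

/-- ★★ **THE REMAINDER ROW OF THE PARTITION-CUT FAR DEFECT IS A FAR TAIL OF THE FULL PERTURBATION** (file 47∕48's `hFK` row): with the data of file 34 for the dressed smooth-cut cube `X`, the
partition function `h` (`|h| ≤ 1`, `|∇^±h| ≤ c₁`, `hψ = h`, `h`, its shifts and `∇^±h` supported in `{χ = 1}`), the full perturbation `V̂_f` and the DISPLAYED far letter of its entries from the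
`χ`-region to outside `ψ`, `(1 − M_ψ)V̂_fC_χ ≤ θ_Fe^{−ρ_Fd}` (`ρ₃ + σ ≤ ρ_F`): `[F, M_h]X ≤ 1_S(y′)·(θ_F(B̄′ + c₁B̄′)c_r)e^{−ρ₃d}`, `B̄′ = β̄(1 − β̄Rc_r²)⁻¹`.
[cite: Balaban1985BackgroundPropagators, (3.34)–(3.35) p.396, (3.63)–(3.65) pp.402–403 (mechanism); Balaban1984PropagatorsII, (2.93) p.239, (2.133)–(2.135) p.247 (shapes)] -/
theorem hasMaj_commOp_farDefect_smoothCutDressed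
    (htri : Triangle254 g) (hd : ∀ a b : g.Site, 0 ≤ g.dist a b) (hrow : RowSum g σ cr) (hσ : 0 ≤ σ) {ρ₁ ρ₂ δV R : ℝ} (hβ : 0 ≤ β) (hβ₁ : 0 ≤ β₁)
    (hct : 0 ≤ ct) (hR : 0 ≤ R) (hcr : 0 ≤ cr) (hσρ : σ ≤ ρ₁) (hρ₁V : ρ₁ ≤ δV) (hρ₁G : ρ₁ + σ ≤ δ) (hρ₂ : 0 ≤ ρ₂) (hρ₂₁ : ρ₂ + σ ≤ ρ₁)
    (hSχ : ∀ x, χX x ≠ 0 → blk x ∈ S) (hSψ : ∀ x, ψX x ≠ 0 → blk x ∈ S) (hχt : ∀ x, |χtX x| ≤ 1)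
    (hdχt : ∀ μ p, |fgrad n (liftEquiv (τ μ) ι) (fun p : X × ι => χtX p.1) p| ≤ ct) (hdχtb : ∀ μ p, |bgrad n (liftEquiv (τ μ) ι) (fun p : X × ι => χtX p.1) p| ≤ ct)
    (hsub : mulOp (fun p : X × ι => χtX p.1) ∘ₗ mulOp (fun p : X × ι => χX p.1) = mulOp (fun p : X × ι => χtX p.1))
    (hχ : mulOp (fun p : X × ι => χX p.1) ∘ₗ mulOp (fun p : X × ι => χtX p.1) = mulOp (fun p : X × ι => χtX p.1))
    (hs : ∀ μ, mulOp ((fun p : X × ι => χtX p.1) ∘ (liftEquiv (τ μ) ι)) ∘ₗ mulOp (fun p : X × ι => χX p.1) = mulOp ((fun p : X × ι => χtX p.1) ∘ (liftEquiv (τ μ) ι)))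
    (hsb : ∀ μ, mulOp ((fun p : X × ι => χtX p.1) ∘ (liftEquiv (τ μ) ι).symm) ∘ₗ mulOp (fun p : X × ι => χX p.1) = mulOp ((fun p : X × ι => χtX p.1) ∘ (liftEquiv (τ μ) ι).symm))
    (hdd : ∀ μ, mulOp (fgrad n (liftEquiv (τ μ) ι) (fun p : X × ι => χtX p.1)) ∘ₗ mulOp (fun p : X × ι => χX p.1) = mulOp (fgrad n (liftEquiv (τ μ) ι) (fun p : X × ι => χtX p.1)))
    (hddb : ∀ μ, mulOp (bgrad n (liftEquiv (τ μ) ι) (fun p : X × ι => χtX p.1)) ∘ₗ mulOp (fun p : X × ι => χX p.1) = mulOp (bgrad n (liftEquiv (τ μ) ι) (fun p : X × ι => χtX p.1)))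
    (hs' : ∀ μ, mulOp (fun p : X × ι => χX p.1) ∘ₗ mulOp ((fun p : X × ι => χtX p.1) ∘ (liftEquiv (τ μ) ι)) = mulOp ((fun p : X × ι => χtX p.1) ∘ (liftEquiv (τ μ) ι)))
    (hsb' : ∀ μ, mulOp (fun p : X × ι => χX p.1) ∘ₗ mulOp ((fun p : X × ι => χtX p.1) ∘ (liftEquiv (τ μ) ι).symm) = mulOp ((fun p : X × ι => χtX p.1) ∘ (liftEquiv (τ μ) ι).symm))
    (hdd' : ∀ μ, mulOp (fun p : X × ι => χX p.1) ∘ₗ mulOp (fgrad n (liftEquiv (τ μ) ι) (fun p : X × ι => χtX p.1)) = mulOp (fgrad n (liftEquiv (τ μ) ι) (fun p : X × ι => χtX p.1)))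
    (hddb' : ∀ μ, mulOp (fun p : X × ι => χX p.1) ∘ₗ mulOp (bgrad n (liftEquiv (τ μ) ι) (fun p : X × ι => χtX p.1)) = mulOp (bgrad n (liftEquiv (τ μ) ι) (fun p : X × ι => χtX p.1)))
    (hNψ : N ∘ₗ mulOp (fun p : X × ι => ψX p.1) = N)
    (hcut : HasMaj (BlockNorm.ofBlocks g (liftBlk blk ι)) (BlockNorm.ofBlocks g (liftBlk blk ι)) (mulOp (fun p : X × ι => χX p.1) ∘ₗ N) (fun y y' => ind S y * ind S y' * (β * Real.exp (-(δ * g.dist y y')))))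
    (hcutF : ∀ μ, HasMaj (BlockNorm.ofBlocks g (liftBlk blk ι)) (BlockNorm.ofBlocks g (liftBlk blk ι)) (mulOp (fun p : X × ι => χX p.1) ∘ₗ (fgrad n (liftEquiv (τ μ) ι) ∘ₗ N)) (fun y y' => ind S y * ind S y' * (β₁ * Real.exp (-(δ * g.dist y y')))))
    (hcutB : ∀ μ, HasMaj (BlockNorm.ofBlocks g (liftBlk blk ι)) (BlockNorm.ofBlocks g (liftBlk blk ι)) (mulOp (fun p : X × ι => χX p.1) ∘ₗ (bgrad n (liftEquiv (τ μ) ι) ∘ₗ N)) (fun y y' => ind S y * ind S y' * (β₁ * Real.exp (-(δ * g.dist y y')))))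
    (hV : HasMaj (BlockNorm.ofBlocks g (blkPair (liftBlk blk ι))) (BlockNorm.ofBlocks g (liftBlk blk ι)) V (fun y y' => R * Real.exp (-(δV * g.dist y y'))))
    (hq : (β + (β₁ + ct * β)) * (R * cr) * cr < 1)
    {c₁ θF ρ₃ ρF : ℝ} (hc₁ : 0 ≤ c₁) (hθF : 0 ≤ θF) (hρ₃ : 0 ≤ ρ₃) (hρ₃₂ : ρ₃ ≤ ρ₂) (hρF : ρ₃ + σ ≤ ρF) (hhabs : ∀ x, |hX x| ≤ 1)
    (hh1 : ∀ μ p, |fgrad n (liftEquiv (τ μ) ι) (fun p : X × ι => hX p.1) p| ≤ c₁) (hh1b : ∀ μ p, |bgrad n (liftEquiv (τ μ) ι) (fun p : X × ι => hX p.1) p| ≤ c₁)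
    (hhψ : mulOp (fun p : X × ι => hX p.1) ∘ₗ mulOp (fun p : X × ι => ψX p.1) = mulOp (fun p : X × ι => hX p.1)) (hχh : mulOp (fun p : X × ι => χX p.1) ∘ₗ mulOp (fun p : X × ι => hX p.1) = mulOp (fun p : X × ι => hX p.1))
    (hhs' : ∀ μ, mulOp (fun p : X × ι => χX p.1) ∘ₗ mulOp ((fun p : X × ι => hX p.1) ∘ (liftEquiv (τ μ) ι)) = mulOp ((fun p : X × ι => hX p.1) ∘ (liftEquiv (τ μ) ι)))
    (hhsb' : ∀ μ, mulOp (fun p : X × ι => χX p.1) ∘ₗ mulOp ((fun p : X × ι => hX p.1) ∘ (liftEquiv (τ μ) ι).symm) = mulOp ((fun p : X × ι => hX p.1) ∘ (liftEquiv (τ μ) ι).symm))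
    (hhdd' : ∀ μ, mulOp (fun p : X × ι => χX p.1) ∘ₗ mulOp (fgrad n (liftEquiv (τ μ) ι) (fun p : X × ι => hX p.1)) = mulOp (fgrad n (liftEquiv (τ μ) ι) (fun p : X × ι => hX p.1)))
    (hhddb' : ∀ μ, mulOp (fun p : X × ι => χX p.1) ∘ₗ mulOp (bgrad n (liftEquiv (τ μ) ι) (fun p : X × ι => hX p.1)) = mulOp (bgrad n (liftEquiv (τ μ) ι) (fun p : X × ι => hX p.1)))
    (hfar : HasMaj (BlockNorm.ofBlocks g (blkPair (liftBlk blk ι))) (BlockNorm.ofBlocks g (liftBlk blk ι)) ((LinearMap.id - mulOp (fun p : X × ι => ψX p.1)) ∘ₗ Vf ∘ₗ mulOp (fun q : (X × ι) × Option (J ⊕ J) => χX q.1.1)) (fun y y' => θF * Real.exp (-(ρF * g.dist y y')))) :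
    HasMaj (BlockNorm.ofBlocks g (liftBlk blk ι)) (BlockNorm.ofBlocks g (liftBlk blk ι)) (commOp (-((Vf - mulOp (fun p : X × ι => ψX p.1) ∘ₗ Vf ∘ₗ mulOp (fun q : (X × ι) × Option (J ⊕ J) => χX q.1.1)) ∘ₗ stack LinearMap.id (fun j => Sum.elim (fun μ => fgrad n (liftEquiv (τ μ) ι)) (fun μ => bgrad n (liftEquiv (τ μ) ι)) j))) (fun p : X × ι => hX p.1) ∘ₗ (projO none ∘ₗ bgPropV (stack (mulOp (fun p : X × ι => χtX p.1) ∘ₗ N) (fun j => Sum.elim (fun μ => fgrad n (liftEquiv (τ μ) ι)) (fun μ => bgrad n (liftEquiv (τ μ) ι)) j ∘ₗ (mulOp (fun p : X × ι => χtX p.1) ∘ₗ N))) V))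
      (fun y y' => ind S y' * (θF * (((β + (β₁ + ct * β)) * (1 - (β + (β₁ + ct * β)) * (R * cr) * cr)⁻¹) + c₁ * ((β + (β₁ + ct * β)) * (1 - (β + (β₁ + ct * β)) * (R * cr) * cr)⁻¹)) * cr * Real.exp (-(ρ₃ * g.dist y y')))) := by
  have hβb : 0 ≤ β + (β₁ + ct * β) := by positivity
  have hqi : 0 ≤ (1 - (β + (β₁ + ct * β)) * (R * cr) * cr)⁻¹ := inv_nonneg.2 (by linarith)
  have hB : 0 ≤ ((β + (β₁ + ct * β)) * (1 - (β + (β₁ + ct * β)) * (R * cr) * cr)⁻¹) := mul_nonneg hβb hqi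
  have hG := hasMaj_smoothCut_flat blk (S := S) hβ hβ₁ hct hχt hsub hcut
  have hD := hasMaj_jet_smoothCut_flat blk τ n (S := S) hβ hβ₁ hct hχt hdχt hdχtb hs hsb hdd hddb hcut hcutF hcutB
  have hunit := (hasMaj_dressedV_pair blk htri hd hrow hσ hβb hR hcr hσρ hρ₁V hρ₁G hρ₂ hρ₂₁ hG hD hV hq).1
  have hS := jetCut_comp_jet_mulOp_comp τ n hχ hs' hsb' hdd' hddb' N
  rw [jet_comp_eq_stack] at hS
  have hX0 := hasMaj_smoothCutDressed_loc₂ blk τ n htri hd hrow hσ hβ hβ₁ hct hR hcr hσρ hρ₁V hρ₁G hρ₂ hρ₂₁ hSχ hSψ hχt hdχt hdχtb hsub hχ hs hsb hdd hddb hNψ hcut hcutF hcutB hV hq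
  have hXF := fun μ => hasMaj_fgrad_smoothCutDressed_loc₂ blk τ n htri hd hrow hσ hβ hβ₁ hct hR hcr hσρ hρ₁V hρ₁G hρ₂ hρ₂₁ hSχ hSψ hχt hdχt hdχtb hsub hs hsb hdd hddb hs' hsb' hdd' hddb' hNψ hcut hcutF hcutB hV hq μ
  have hXB := fun μ => hasMaj_bgrad_smoothCutDressed_loc₂ blk τ n htri hd hrow hσ hβ hβ₁ hct hR hcr hσρ hρ₁V hρ₁G hρ₂ hρ₂₁ hSχ hSψ hχt hdχt hdχtb hsub hs hsb hdd hddb hs' hsb' hdd' hddb' hNψ hcut hcutF hcutB hV hq μ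
  have hY := hasMaj_jet_mulOp_comp_loc₂ blk τ n (S := S) hB hc₁ hhabs hh1 hh1b hX0 hXF hXB
  have hYloc := jetCut_comp_jet_mulOp_comp τ n hχh hhs' hhsb' hhdd' hhddb' (projO none ∘ₗ bgPropV (stack (mulOp (fun p : X × ι => χtX p.1) ∘ₗ N) (fun j => Sum.elim (fun μ => fgrad n (liftEquiv (τ μ) ι)) (fun μ => bgrad n (liftEquiv (τ μ) ι)) j ∘ₗ (mulOp (fun p : X × ι => χtX p.1) ∘ₗ N))) V)
  rw [commOp_farDefect_comp_dressed_eq (fun _ => rfl) hunit hS hhψ Vf hYloc]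
  exact (hasMaj_comp_exp_in (blkPair (liftBlk blk ι)) htri hd hrow hθF (by positivity) hρ₃ hρ₃₂ hρF hfar hY).neg

end SmoothCut

end Summit.QuantumFields.YangMills.BalabanUVNodes.N15.CurvedSpecies

end
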